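import Summits.QuantumFields.YangMills.Theorems.LuscherReductionOneSiteLevelsValleyAsymp
import Summits.QuantumFields.YangMills.Theorems.LuscherReductionOneSiteLevelsValleyReduction
import Summits.QuantumFields.YangMills.Theorems.FemtoTransferGapSlabRayleigh

/-!
# VALLEY, final step: the one-site valley form bound `OneSiteAbsUpperValleyMag k` for every `k`
# (closes `stub_absUpperValleyMag` of the line `birth` for crux `OneSiteLevels`, route `LuscherReduction`, item stmt-QuantumFields-20007;
# fleet lead prover ym-luscher-20007-p1 g2)

With `u = B^{1/12}` and the parameter choice `T = u⁻¹`, `w = u⁻⁵`, `δ' = u⁻⁸`, `ρ₀ = √λ_b/2`, `γ = u⁻³/1000`, `J = ⌊u⁴/2⌋`, the static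
valley bound `valley_qform_le_static`, its numerical hypotheses (`…ValleyAsymp`) and the exponentially small boundary term
(`tail_exp_le`, from `gauss_le_linkCE` and `xⁿe^{−x} → 0`) give the k-UNIFORM VALLEY GAIN

  `qform_B(f,f) ≤ linkCE B · (1 − B^{−1/4}/2000) · ‖f‖²`   (`B ≥ B₀`, `f` bounded measurable, `f = 0` on `{‖zmCoord 1 U‖² < λ_b/4}`)

(`valley_gain`), and `absUpperValleyMag_of_gain` (`…ValleyReduction`) turns it into the statement of the stub for every level `k`
(`oneSiteAbsUpperValleyMag`, stated with the body of `OneSiteAbsUpperValleyMag k` verbatim; `C₁ = 0`).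

Mechanism (B. Simon 1983, semiclassical localisation away from the valley bottom; Lüscher 1983 §2): a positive supersolution
(Schur test) for the one-site transfer kernel on the region `{ρ ≥ ρ₀}`, with the weight `e^{−BS/(8t)}` on the lower radial shell and
`1` on the upper shell, the shell boundary pigeonholed per test function; the deficiency comes from the transverse Hessian of the
one-site action (zero-point energy of the kinetic Gaussian step), uniformly `≳ B^{−1/4}`.

## WHAT THIS IS NOT
One stub of one line of the crux `OneSiteLevels`; NOT the crux, NOT `LuscherBridge`, NOT THE CLAY GAP.  Sorry-free; no new definition,
no named fact.
-/

set_option autoImplicit false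

noncomputable section

open MeasureTheory Filter Topology Real
open scoped Matrix Quaternion RealInnerProductSpace BigOperators
open Literature.MathematicalPhysics.QuantumFieldTheory
open Literature.MathematicalPhysics.QuantumLattice
open Literature.Analysis.OperatorTheory.YMMatrixModel

namespace Summit.QuantumFields.YangMills.Theorems.FemtoTransferGap

/-! ### §1. The exponentially small boundary term -/

/-- **Boundary term**: eventually in `u`, `2e^{6u¹² − u¹²(u⁻⁵)²} ≤ linkCE(u¹²) · u⁻³/4000`. [folklore] -/
theorem tail_exp_le : ∃ u₁ : ℝ, ∀ u : ℝ, u₁ ≤ u →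
    2 * Real.exp (6 * u ^ 12 - u ^ 12 * ((u⁻¹) ^ 5) ^ 2) ≤ linkCE (u ^ 12) * ((u⁻¹) ^ 3 / 4000) := by
  -- the constant
  set c : ℝ := Real.sqrt π ^ 9 / (16000 * (2 * π ^ 2) ^ 3) with hc
  have hc0 : 0 < c := by rw [hc]; positivity
  have hlim := (Real.tendsto_pow_mul_exp_neg_atTop_nhds_zero 29).eventually (eventually_le_nhds hc0)
  obtain ⟨x₁, hx₁⟩ := Filter.eventually_atTop.1 hlim
  refine ⟨max 2 (max x₁ 1), fun u hu => ?_⟩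
  have hu2 : 2 ≤ u := le_trans (le_max_left _ _) hu
  have hux : x₁ ≤ u := le_trans (le_trans (le_max_left _ _) (le_max_right _ _)) hu
  have hu0 : 0 < u := by linarith
  have hu1 : 1 ≤ u := by linarith
  -- `u⁵⁷ e^{−u²} ≤ c`
  have hx : x₁ ≤ u ^ 2 := by nlinarith
  have h1 := hx₁ (u ^ 2) hx
  have hu57 : u ^ 57 * Real.exp (-(u ^ 2)) ≤ c := by
    have : u ^ 57 ≤ (u ^ 2) ^ 29 := by rw [← pow_mul]; exact pow_le_pow_right₀ hu1 (by norm_num)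
    have h0 := Real.exp_pos (-(u ^ 2))
    nlinarith
  -- the Gaussian lower bound for `linkCE`
  have hB0 : 0 < u ^ 12 := by positivity
  have hB54 : (54 : ℝ) ≤ u ^ 12 := le_trans (by norm_num) (pow_le_pow_left₀ (by norm_num) hu2 12)
  have hG := gauss_le_linkCE hB0
  have h27 : (1 : ℝ) / 2 ≤ 1 - 27 / u ^ 12 := by
    have : 27 / u ^ 12 ≤ 1 / 2 := by rw [div_le_iff₀ hB0]; linarith
    linarith
  have hsq : Real.sqrt (π / u ^ 12) = Real.sqrt π * (u ^ 6)⁻¹ := ValleyAsymp.sqrt_div_pow_twelve hu0 π Real.pi_pos.le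
  have hGval : Real.exp (6 * u ^ 12) * Real.sqrt (π / u ^ 12) ^ 9 / (2 * π ^ 2) ^ 3
      = Real.exp (6 * u ^ 12) * Real.sqrt π ^ 9 * (u ^ 54)⁻¹ / (2 * π ^ 2) ^ 3 := by
    rw [hsq, mul_pow, ← inv_pow, ← pow_mul]; ring
  have hL : Real.exp (6 * u ^ 12) * Real.sqrt π ^ 9 * (u ^ 54)⁻¹ / (2 * π ^ 2) ^ 3 ≤ 2 * linkCE (u ^ 12) := by
    rw [← hGval]
    have h0 : 0 ≤ Real.exp (6 * u ^ 12) * Real.sqrt (π / u ^ 12) ^ 9 / (2 * π ^ 2) ^ 3 := by positivity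
    nlinarith
  -- assemble
  have e : 6 * u ^ 12 - u ^ 12 * ((u⁻¹) ^ 5) ^ 2 = 6 * u ^ 12 + -(u ^ 2) := by field_simp; ring
  rw [e, Real.exp_add]
  have hE := Real.exp_pos (6 * u ^ 12)
  -- 2 e^{6B} e^{-u²} ≤ 2 e^{6B} c u^{-57} = e^{6B} √π⁹ u^{-54}/(2π²)³ · u^{-3}/8000 ≤ 2 linkCE · u^{-3}/8000
  have hexp : Real.exp (-(u ^ 2)) ≤ c * (u ^ 57)⁻¹ := by
    rw [le_mul_inv_iff₀ (by positivity)]; linarith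
  have key : 2 * (Real.exp (6 * u ^ 12) * Real.exp (-(u ^ 2)))
      ≤ (Real.exp (6 * u ^ 12) * Real.sqrt π ^ 9 * (u ^ 54)⁻¹ / (2 * π ^ 2) ^ 3) * ((u⁻¹) ^ 3 / 8000) := by
    have := mul_le_mul_of_nonneg_left hexp hE.le
    have e2 : Real.exp (6 * u ^ 12) * (c * (u ^ 57)⁻¹)
        = (Real.exp (6 * u ^ 12) * Real.sqrt π ^ 9 * (u ^ 54)⁻¹ / (2 * π ^ 2) ^ 3) * ((u⁻¹) ^ 3 / 8000) / 2 := by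
      rw [hc]; field_simp; ring
    rw [e2] at this
    linarith
  calc 2 * (Real.exp (6 * u ^ 12) * Real.exp (-(u ^ 2)))
      ≤ (Real.exp (6 * u ^ 12) * Real.sqrt π ^ 9 * (u ^ 54)⁻¹ / (2 * π ^ 2) ^ 3) * ((u⁻¹) ^ 3 / 8000) := key
    _ ≤ (2 * linkCE (u ^ 12)) * ((u⁻¹) ^ 3 / 8000) := mul_le_mul_of_nonneg_right hL (by positivity)
    _ = linkCE (u ^ 12) * ((u⁻¹) ^ 3 / 4000) := by ring

/-! ### §2. The k-uniform valley gain -/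

/-- `u = B^{1/12}`: `u¹² = B`, `B^{−1/4} = (u⁻¹)³`, monotone in `B`. [folklore] -/
theorem twelfth_root_facts {B u₀ : ℝ} (hu₀ : 0 ≤ u₀) (hB : u₀ ^ 12 ≤ B) (hB0 : 0 < B) :
    (B ^ ((1 : ℝ) / 12)) ^ 12 = B ∧ u₀ ≤ B ^ ((1 : ℝ) / 12) ∧ B ^ (-(1 / 4 : ℝ)) = ((B ^ ((1 : ℝ) / 12))⁻¹) ^ 3 := by
  refine ⟨?_, ?_, ?_⟩
  · rw [show ((1 : ℝ) / 12) = ((12 : ℕ) : ℝ)⁻¹ by norm_num]; exact Real.rpow_inv_natCast_pow hB0.le (by norm_num)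
  · calc u₀ = (u₀ ^ 12) ^ ((1 : ℝ) / 12) := by
          rw [show ((1 : ℝ) / 12) = ((12 : ℕ) : ℝ)⁻¹ by norm_num, Real.pow_rpow_inv_natCast hu₀ (by norm_num)]
      _ ≤ B ^ ((1 : ℝ) / 12) := Real.rpow_le_rpow (by positivity) hB (by norm_num)
  · rw [inv_pow, ← Real.rpow_natCast, ← Real.rpow_mul hB0.le, ← Real.rpow_neg hB0.le]
    norm_num

/-- **THE k-UNIFORM VALLEY GAIN.**  For `B ≥ B₀`, every bounded measurable `f` vanishing on `{‖zmCoord 1 U‖² < λ_b/4}` satisfies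
`qform_B(f,f) ≤ linkCE B (1 − B^{−1/4}/2000) ‖f‖²`. [cite: SimonB1983DiscreteSpectrum, §2] [cite: Luscher1983, §2] -/
theorem valley_gain : ∃ B₀ : ℝ, ∀ B : ℝ, B₀ ≤ B → ∀ f : Cfg → ℝ, Measurable f → (∃ C : ℝ, ∀ U, |f U| ≤ C) →
    (∀ U, ‖zmCoord 1 U‖ ^ 2 < bareLambda B / 4 → f U = 0) →
    qform su2Rep B f f ≤ linkCE B * (1 - 1 / 2000 * B ^ (-(1 / 4 : ℝ))) * l2 f f := by
  obtain ⟨u₁, hu₁⟩ := tail_exp_le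
  set u₀ : ℝ := max 20000 u₁ with hu₀
  have hu₀0 : 0 ≤ u₀ := le_trans (by norm_num) (le_max_left _ _)
  refine ⟨u₀ ^ 12, fun B hB f hfm hfb hf0 => ?_⟩
  have hB0 : 0 < B := by
    have h1 : (0:ℝ) < 20000 ^ 12 := by positivity
    have h2 : (20000:ℝ) ^ 12 ≤ u₀ ^ 12 := pow_le_pow_left₀ (by norm_num) (le_max_left _ _) 12
    linarith
  obtain ⟨hBu, hu, hquart⟩ := twelfth_root_facts hu₀0 hB hB0
  set u : ℝ := B ^ ((1 : ℝ) / 12) with hudef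
  clear_value u
  have hu20000 : 20000 ≤ u := le_trans (le_max_left _ _) hu
  have huu₁ : u₁ ≤ u := le_trans (le_max_right _ _) hu
  have hu0 : 0 < u := by linarith
  have hu1 : 1 ≤ u := by linarith
  subst hBu
  -- the hypotheses of the static bound
  obtain ⟨h54, hT, hw, hρ₀0, hρ₀w, hJ, hJw, hδ'0, hδ', hγ, hJinv⟩ := ValleyAsymp.geom_hyps hu20000
  have h1a := ValleyAsymp.hyp_h1a hu20000
  have h1b := ValleyAsymp.hyp_h1b hu20000
  have h2a := ValleyAsymp.hyp_h2a hu20000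
  have h2b := ValleyAsymp.hyp_h2b hu20000
  have h2c := ValleyAsymp.hyp_h2c hu20000
  have htail := hu₁ u huu₁
  have hvle : u⁻¹ ≤ 1 / 20000 := by rw [inv_eq_one_div]; exact one_div_le_one_div_of_le (by norm_num) hu20000
  have hv0 : 0 < u⁻¹ := by positivity
  have hv1 : u⁻¹ ≤ 1 := by linarith
  have hε₁ : 9 / 4 * (u⁻¹) ^ 8 + (1 / 2 + 1 / (8 * u⁻¹)) * (2 * Real.sqrt 2 * √(10 / u ^ 12) + 9 * (u⁻¹) ^ 8 * (2 + 36 * (u⁻¹) ^ 8))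
      ≤ 1 / 18 := by
    refine (ValleyAsymp.eps1_le hu1).trans ?_
    have : (u⁻¹) ^ 5 ≤ (u⁻¹) ^ 1 := pow_le_pow_of_le_one hv0.le hv1 (by norm_num)
    rw [pow_one] at this
    linarith
  have hε₂ : 9 / 4 * (u⁻¹) ^ 8 + 1 / 2 * (2 * Real.sqrt 2 * √(1 / (100000 * u ^ 12)) + 9 * (u⁻¹) ^ 8 * (2 + 36 * (u⁻¹) ^ 8))
      ≤ 1 / 18 := by
    refine (ValleyAsymp.eps2_le hu1).trans ?_
    have : (u⁻¹) ^ 6 ≤ (u⁻¹) ^ 1 := pow_le_pow_of_le_one hv0.le hv1 (by norm_num)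
    rw [pow_one] at this
    linarith
  -- vanishing below `ρ₀ = √λ_b/2`
  have hf0' : ∀ U, ‖zmCoord 1 U‖ < Real.sqrt (bareLambda (u ^ 12)) / 2 → f U = 0 := by
    intro U hU
    refine hf0 U ?_
    have h0 : 0 ≤ ‖zmCoord 1 U‖ := norm_nonneg _
    have hlam0 : 0 ≤ bareLambda (u ^ 12) := by
      obtain ⟨hlam, h1, _⟩ := ValleyAsymp.bareLambda_pow_twelve hu0
      rw [hlam]; positivity
    have hsq : (Real.sqrt (bareLambda (u ^ 12)) / 2) ^ 2 = bareLambda (u ^ 12) / 4 := by rw [div_pow, Real.sq_sqrt hlam0]; norm_num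
    rw [← hsq]
    exact pow_lt_pow_left₀ hU h0 two_ne_zero
  have hstat := valley_qform_le_static h54 hT hw hρ₀0 hρ₀w hJ hJw hδ'0 hδ' hε₁ hε₂ hγ h1a h1b h2a h2b h2c hfm hfb hf0'
  -- collect
  have hL : 0 < linkCE (u ^ 12) := linkCE_pos (by positivity)
  have hl2 : 0 ≤ l2 f f := l2_self_nonneg f
  have hJ' : linkCE (u ^ 12) / (⌊u ^ 4 / 2⌋₊ : ℕ) ≤ linkCE (u ^ 12) * ((u⁻¹) ^ 3 / 4000) := by
    rw [div_eq_mul_one_div]; exact mul_le_mul_of_nonneg_left hJinv hL.le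
  rw [hquart]
  refine hstat.trans ?_
  have : linkCE (u ^ 12) * (1 - (u⁻¹) ^ 3 / 1000) + linkCE (u ^ 12) / (⌊u ^ 4 / 2⌋₊ : ℕ)
      + 2 * Real.exp (6 * u ^ 12 - u ^ 12 * ((u⁻¹) ^ 5) ^ 2) ≤ linkCE (u ^ 12) * (1 - 1 / 2000 * (u⁻¹) ^ 3) := by
    nlinarith
  exact mul_le_mul_of_nonneg_right this hl2

/-! ### §3. The stub -/

/-- **THE VALLEY STUB** `stub_absUpperValleyMag` of line `birth` (crux `OneSiteLevels`): for every level `k`, the one-site valley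
piece `f = cos Θ · sin Φ · ψ` has `qform_B(f,f) ≤ linkCE B · e^{−E_{k+1}λ_b + C₁λ_b²} ‖f‖²` for `B ≥ B₁(k)` (with `C₁ = 0`).  Stated with
the body of `Summit.QuantumFields.YangMills.Cruxes.OneSiteLevels.Birth.OneSiteAbsUpperValleyMag k` verbatim (Theorems files may not
import the crux workfile); the skeleton discharges its stub by `fun k => oneSiteAbsUpperValleyMag k`.
[cite: SimonB1983DiscreteSpectrum, §2] [cite: Luscher1983, §2] -/
theorem oneSiteAbsUpperValleyMag (k : ℕ) :
    ∃ C₁ B₁ : ℝ, 2 ≤ B₁ ∧ ∀ B, B₁ ≤ B → ∀ ψ : Cfg → ℝ, IsPhys ψ →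
      qform su2Rep B (fun U => Real.cos (magPhase (onePhaseScale B) U) * (Real.sin (onePhase (onePhaseScale B) U) * ψ U))
          (fun U => Real.cos (magPhase (onePhaseScale B) U) * (Real.sin (onePhase (onePhaseScale B) U) * ψ U))
        ≤ linkCE B * Real.exp (-(physLevel (k + 1) * bareLambda B) + C₁ * bareLambda B ^ 2)
          * l2 (fun U => Real.cos (magPhase (onePhaseScale B) U) * (Real.sin (onePhase (onePhaseScale B) U) * ψ U))
               (fun U => Real.cos (magPhase (onePhaseScale B) U) * (Real.sin (onePhase (onePhaseScale B) U) * ψ U)) := by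
  obtain ⟨B₀, hB₀⟩ := valley_gain
  exact absUpperValleyMag_of_gain (c₀ := 1 / 2000) (a := 1 / 4) (B₀ := B₀) (by norm_num) (by norm_num) hB₀ k

end Summit.QuantumFields.YangMills.Theorems.FemtoTransferGap

end
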